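import Literature.AlgebraicGeometry.Pohlmann1968.CMTypeRankLowerBoundsNumberField
import Literature.FieldTheory.AlgClosed.AutFixedSubfield
import Literature.NumberTheory.Automorphic.AdelicSecondCountable
import Literature.NumberTheory.ComplexMultiplication.CMTypeBasic
import Summits.HodgeConjecture.CorCM.CyclicSexticCMTypes
import HarnessLib

/-!
# CM types of a QUARTIC CM field, I: the four embeddings, `Aut(K)`, the dihedral reflection, primitivity

COR-CM (cell `pub-hodgecm2`), seat b24, count-neutral lane QUARTIC-SLICE (degree-4 slice of `HC_CM`, unconditional;
sequels `CorCM/QuarticCMTypePairNondegenerate.lean`, `CorCM/QuarticCMTypeSlice.lean`).  Everything is PROVED; theorems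
only; no definition, no named fact.

`K` a quartic CM field, `Hom(K, ℂ) = {a, ā, b, b̄}`; `Aut(ℂ)` acts by composition (scoped `ringEquivCompAction`),
commuting with `s ↦ s̄`, through a subgroup of the centraliser `C(c) ≅ D₄` of `c = (a ā)(b b̄)`: the regular `C₄`
(cyclic `K`), the regular Klein group (biquadratic `K`) or all of `D₄` (`K/ℚ` not normal).
* §1 `eq_or_eq_or_eq_or_eq`, `sum_eq_add_four` (bookkeeping on the four embeddings), `exists_mem_mem_ne` (a CM type is
  `{a, b}`, `b ∉ {a, ā}`), `exists_pair_presentation` (two types `Ψ ∉ {Φ, Φ̄}` are `{a, b}`, `{a, b̄}` after relabelling).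
* §2 `algEquiv_eq_one_or_eq_conjGal_of_not_isGalois` — `K/ℚ` not Galois ⟹ `Aut(K) = {1, c}`.
* §3 **`exists_ringAut_smul_eq_self_smul_eq_conjugate`** — THE REFLECTION: if `b` is not a twist `a ∘ g`, `g ∈ Aut(K)`,
  some `τ ∈ Aut(ℂ)` has `τ ∘ a = a`, `τ ∘ b = b̄` (`b(K) ⊄ a(K)`, so some `b(x)` is moved by an automorphism of `ℂ` fixing
  the countable subfield `a(K)` — `Literature.FieldTheory.AlgClosed.Complex.exists_ringEquiv_fix_apply_ne` — which then
  moves `b` inside `{a, ā, b, b̄}` to `b̄`); for `K/ℚ` not Galois it applies to every `b ∉ {a, ā}`.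
* §4 **`isPrimitive_of_not_isGalois`**, **`isNondegenerate_of_not_isGalois`** — `{1, τ}` separate the four embeddings,
  so every CM type of a non-Galois quartic CM field is primitive (its abelian surfaces are simple), hence
  NONDEGENERATE by Ribet's bound (`Pohlmann1968.isNondegenerate_of_isPrimitive_of_finrank_le_six`): all powers of its
  abelian surfaces have `B• = D•` and satisfy the Hodge conjecture (`Pohlmann1968/NondegenerateCMTypeHodgeConjecture`).
Print counterpart: Moonen–Zarhin 1999, section "Hodge groups of simple abelian surfaces of CM-type"; Ribet 1980 (3.7);
Shimura §8.2 Prop. 26; the permutation model `D₄ = {rʲsᶠ}` of the census `CorCM/Census/DihedralSurfaceTriple.lean`.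

## References
* [MoonenZarhin1999LowDim] B. Moonen, Yu. Zarhin, Math. Ann. 315 (1999) 711–733, section "Hodge groups of simple
  abelian surfaces of CM-type".
* [Ribet1980] K. Ribet, *Division fields of abelian varieties with complex multiplication*, Mém. SMF 2 (1980), (3.7).
* [Shimura1998] G. Shimura, *Abelian Varieties with Complex Multiplication and Modular Functions*, §8.2 Prop. 26.
-/

noncomputable section

open NumberField NumberField.ComplexEmbedding
open scoped Cardinal

namespace Summit.HodgeConjecture.CorCM.QuarticCM

open Literature.NumberTheory.ComplexMultiplication
open Literature.NumberTheory.ComplexMultiplication.CMTypeOps (bar mem_bar_iff conjugate_mem_iff_notMem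
  mem_iff_conjugate_notMem)
open Literature.AlgebraicGeometry.Motives (CMType)
open Literature.AlgebraicGeometry.Pohlmann1968
open Summit.HodgeConjecture.CorCM.CyclicSextic (conjugate_eq_comp_conjGal orderOf_conjGal)

variable {K : Type} [Field K] [NumberField K] [IsCMField K]

/-! ## §1 The four complex embeddings of a quartic CM field -/

omit [IsCMField K] in
/-- A quartic field has four complex embeddings. [folklore] -/
theorem card_ringHom_eq_four (h4 : Module.finrank ℚ K = 4) : Fintype.card (K →+* ℂ) = 4 := by
  rw [Embeddings.card, h4]

/-- No complex embedding of a CM field is real: `s̄ ≠ s`. [folklore] -/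
theorem conjugate_ne (s : K →+* ℂ) : conjugate s ≠ s := fun h =>
  IsTotallyComplex.complexEmbedding_not_isReal s (ComplexEmbedding.isReal_iff.2 h)

/-- `τ ∘ s̄ = \overline{τ ∘ s}` for `τ ∈ Aut(ℂ)` and `s : K → ℂ`, `K` a CM field (complex conjugation of `K` is
carried to that of `ℂ` by every embedding). [folklore] -/
theorem smul_conjugate (τ : ℂ ≃+* ℂ) (s : K →+* ℂ) : τ • conjugate s = conjugate (τ • s) := by
  refine RingHom.ext fun x => ?_
  change τ (starRingEnd ℂ (s x)) = starRingEnd ℂ (τ (s x))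
  rw [← IsCMField.complexEmbedding_complexConj K s x]
  exact IsCMField.complexEmbedding_complexConj K ((τ : ℂ →+* ℂ).comp s) x

section Four

variable {a b : K →+* ℂ}

open scoped Classical in
/-- The four embeddings `a, ā, b, b̄` are pairwise distinct and exhaust `Hom(K, ℂ)` (as a `Finset`). [folklore] -/
theorem univ_eq_four (h4 : Module.finrank ℚ K = 4) (hba : b ≠ a) (hba' : b ≠ conjugate a) :
    (Finset.univ : Finset (K →+* ℂ)) = {a, conjugate a, b, conjugate b} := by
  have hab' : conjugate b ≠ a := fun h => hba' (by rw [← h, involutive_conjugate K b])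
  have hcc : conjugate b ≠ conjugate a := fun h => hba ((involutive_conjugate K).injective h)
  have hcard : ({a, conjugate a, b, conjugate b} : Finset (K →+* ℂ)).card = 4 := by
    rw [Finset.card_insert_of_notMem (by simp [(conjugate_ne a).symm, hba.symm, hab'.symm]),
      Finset.card_insert_of_notMem (by simp [hba'.symm, hcc.symm]), Finset.card_pair (conjugate_ne b).symm]
  exact (Finset.eq_univ_of_card _ (by rw [hcard, card_ringHom_eq_four h4])).symm

/-- **`Hom(K, ℂ) = {a, ā, b, b̄}`** for a quartic CM field and `b ∉ {a, ā}`. [folklore] -/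
theorem eq_or_eq_or_eq_or_eq (h4 : Module.finrank ℚ K = 4) (hba : b ≠ a) (hba' : b ≠ conjugate a)
    (s : K →+* ℂ) : s = a ∨ s = conjugate a ∨ s = b ∨ s = conjugate b := by
  classical
  have hs : s ∈ ({a, conjugate a, b, conjugate b} : Finset (K →+* ℂ)) :=
    univ_eq_four h4 hba hba' ▸ Finset.mem_univ s
  simpa using hs

/-- `Σ_{s : K → ℂ} g(s) = g(a) + g(ā) + g(b) + g(b̄)`. [folklore] -/
theorem sum_eq_add_four {M : Type*} [AddCommMonoid M] (h4 : Module.finrank ℚ K = 4) (hba : b ≠ a)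
    (hba' : b ≠ conjugate a) (g : (K →+* ℂ) → M) :
    ∑ s, g s = g a + g (conjugate a) + g b + g (conjugate b) := by
  classical
  have hab' : conjugate b ≠ a := fun h => hba' (by rw [← h, involutive_conjugate K b])
  have hcc : conjugate b ≠ conjugate a := fun h => hba ((involutive_conjugate K).injective h)
  rw [univ_eq_four h4 hba hba', Finset.sum_insert (by simp [(conjugate_ne a).symm, hba.symm, hab'.symm]),
    Finset.sum_insert (by simp [hba'.symm, hcc.symm]), Finset.sum_pair (conjugate_ne b).symm, add_assoc, add_assoc]

end Four

/-- **A CM type of a quartic CM field is a pair `{a, b}` with `b ∉ {a, ā}`.** [folklore] -/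
theorem exists_mem_mem_ne (h4 : Module.finrank ℚ K = 4) (Φ : CMType K) :
    ∃ a b : K →+* ℂ, b ≠ a ∧ b ≠ conjugate a ∧ ∀ s, s ∈ Φ.1 ↔ s = a ∨ s = b := by
  classical
  obtain ⟨a₀⟩ : Nonempty (K →+* ℂ) := inferInstance
  -- an element `a ∈ Φ`
  obtain ⟨a, ha⟩ : ∃ a, a ∈ Φ.1 := by
    rcases CMTypeOps.mem_or_conjugate_mem Φ a₀ with h | h
    exacts [⟨a₀, h⟩, ⟨conjugate a₀, h⟩]
  -- an embedding outside `{a, ā}`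
  obtain ⟨s, -, hs⟩ : ∃ s, s ∈ (Finset.univ : Finset (K →+* ℂ)) ∧ s ∉ ({a, conjugate a} : Finset (K →+* ℂ)) :=
    Finset.exists_mem_notMem_of_card_lt_card
      (lt_of_le_of_lt Finset.card_le_two (by rw [Finset.card_univ, card_ringHom_eq_four h4]; norm_num))
  simp only [Finset.mem_insert, Finset.mem_singleton, not_or] at hs
  obtain ⟨hsa, hsa'⟩ := hs
  -- the element of `Φ` over the place of `s`
  obtain ⟨b, hb, hbs⟩ : ∃ b, b ∈ Φ.1 ∧ (b = s ∨ b = conjugate s) := by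
    rcases CMTypeOps.mem_or_conjugate_mem Φ s with h | h
    exacts [⟨s, h, Or.inl rfl⟩, ⟨conjugate s, h, Or.inr rfl⟩]
  have hba : b ≠ a := by
    rcases hbs with h | h <;> rw [h]
    · exact hsa
    · intro h'; exact hsa' (by rw [← h', involutive_conjugate K])
  have hba' : b ≠ conjugate a := fun h => (mem_iff_conjugate_notMem Φ a).1 ha (h ▸ hb)
  refine ⟨a, b, hba, hba', fun t => ⟨fun ht => ?_, ?_⟩⟩
  · rcases eq_or_eq_or_eq_or_eq h4 hba hba' t with h | h | h | h
    · exact Or.inl h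
    · exact absurd (h ▸ ht) ((mem_iff_conjugate_notMem Φ a).1 ha)
    · exact Or.inr h
    · exact absurd (h ▸ ht) ((mem_iff_conjugate_notMem Φ b).1 hb)
  · rintro (rfl | rfl)
    exacts [ha, hb]

/-- **Relabelling for a second type.**  If `Ψ ≠ Φ` and `Ψ ≠ Φ̄` then, for suitable `a, b` with `b ∉ {a, ā}`,
`Φ = {a, b}` and `Ψ = {a, b̄}` (the two types share exactly one embedding). [folklore] -/
theorem exists_pair_presentation (h4 : Module.finrank ℚ K = 4) {Φ Ψ : CMType K} (h₁ : Ψ ≠ Φ) (h₂ : Ψ ≠ bar Φ) :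
    ∃ a b : K →+* ℂ, b ≠ a ∧ b ≠ conjugate a ∧ (∀ s, s ∈ Φ.1 ↔ s = a ∨ s = b) ∧
      (∀ s, s ∈ Ψ.1 ↔ s = a ∨ s = conjugate b) := by
  obtain ⟨a, b, hba, hba', hΦ⟩ := exists_mem_mem_ne h4 Φ
  have hab' : conjugate b ≠ a := fun h => hba' (by rw [← h, involutive_conjugate K b])
  have hcc : conjugate b ≠ conjugate a := fun h => hba ((involutive_conjugate K).injective h)
  have ha : a ∈ Φ.1 := (hΦ a).2 (Or.inl rfl)
  have hb : b ∈ Φ.1 := (hΦ b).2 (Or.inr rfl)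
  have hna : conjugate a ∉ Φ.1 := (mem_iff_conjugate_notMem Φ a).1 ha
  have hnb : conjugate b ∉ Φ.1 := (mem_iff_conjugate_notMem Φ b).1 hb
  have hΨna : conjugate a ∈ Ψ.1 ↔ a ∉ Ψ.1 := conjugate_mem_iff_notMem Ψ a
  have hΨnb : conjugate b ∈ Ψ.1 ↔ b ∉ Ψ.1 := conjugate_mem_iff_notMem Ψ b
  by_cases hΨa : a ∈ Ψ.1 <;> by_cases hΨb : b ∈ Ψ.1
  · -- `Ψ = Φ`
    refine absurd (Subtype.ext (Set.ext fun s => ?_)) h₁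
    rcases eq_or_eq_or_eq_or_eq h4 hba hba' s with h | h | h | h <;> rw [h]
    · exact iff_of_true hΨa ha
    · exact iff_of_false (fun h' => hΨna.1 h' hΨa) hna
    · exact iff_of_true hΨb hb
    · exact iff_of_false (fun h' => hΨnb.1 h' hΨb) hnb
  · -- `Ψ = {a, b̄}`
    refine ⟨a, b, hba, hba', hΦ, fun s => ?_⟩
    rcases eq_or_eq_or_eq_or_eq h4 hba hba' s with h | h | h | h <;> rw [h]
    · exact iff_of_true hΨa (Or.inl rfl)
    · exact iff_of_false (fun h' => hΨna.1 h' hΨa) (by simp [conjugate_ne a, hcc.symm])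
    · exact iff_of_false hΨb (by simp [hba, (conjugate_ne b).symm])
    · exact iff_of_true (hΨnb.2 hΨb) (Or.inr rfl)
  · -- `Ψ = {ā, b}`: relabel `(a, b) ↦ (b, a)`
    refine ⟨b, a, hba.symm, hab'.symm, fun s => (hΦ s).trans or_comm, fun s => ?_⟩
    rcases eq_or_eq_or_eq_or_eq h4 hba hba' s with h | h | h | h <;> rw [h]
    · exact iff_of_false hΨa (by simp [hba.symm, (conjugate_ne a).symm])
    · exact iff_of_true (hΨna.2 hΨa) (Or.inr rfl)
    · exact iff_of_true hΨb (Or.inl rfl)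
    · exact iff_of_false (fun h' => hΨnb.1 h' hΨb) (by simp [conjugate_ne b, hcc])
  · -- `Ψ = Φ̄`
    refine absurd (Subtype.ext (Set.ext fun s => ?_)) h₂
    rw [mem_bar_iff]
    rcases eq_or_eq_or_eq_or_eq h4 hba hba' s with h | h | h | h <;> rw [h]
    · exact iff_of_false hΨa (not_not.2 ha)
    · exact iff_of_true (hΨna.2 hΨa) hna
    · exact iff_of_false hΨb (not_not.2 hb)
    · exact iff_of_true (hΨnb.2 hΨb) hnb

/-! ## §2 The automorphism group of a non-Galois quartic CM field is `{1, c}` -/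

omit [IsCMField K] in
/-- `|Aut(K)| ≤ 4`: `g ↦ a ∘ g` embeds `Aut(K)` into the four complex embeddings. [folklore] -/
theorem card_algEquiv_le_four (h4 : Module.finrank ℚ K = 4) : Fintype.card (K ≃ₐ[ℚ] K) ≤ 4 := by
  classical
  obtain ⟨a⟩ : Nonempty (K →+* ℂ) := inferInstance
  rw [← card_ringHom_eq_four h4]
  refine Fintype.card_le_of_injective (fun g : K ≃ₐ[ℚ] K => a.comp g.toRingEquiv.toRingHom) fun g g' h => ?_
  ext x
  exact a.injective (RingHom.congr_fun h x)

/-- **For a quartic CM field which is NOT Galois over `ℚ`, `Aut(K) = {1, c}`** (`|Aut(K)| < 4` and `c` has order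
`2`, so `|Aut(K)| = 2`). [folklore] -/
theorem algEquiv_eq_one_or_eq_conjGal_of_not_isGalois (h4 : Module.finrank ℚ K = 4) (hK : ¬IsGalois ℚ K)
    (g : K ≃ₐ[ℚ] K) : g = 1 ∨ g = conjGal := by
  classical
  have hle := card_algEquiv_le_four h4
  have hne : Fintype.card (K ≃ₐ[ℚ] K) ≠ 4 := fun h =>
    hK (IsGalois.of_card_aut_eq_finrank ℚ K (by rw [Nat.card_eq_fintype_card, h, h4]))
  have hdvd : 2 ∣ Fintype.card (K ≃ₐ[ℚ] K) := by
    rw [← orderOf_conjGal (K := K)]; exact orderOf_dvd_card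
  have hcard : Fintype.card (K ≃ₐ[ℚ] K) = 2 := by
    obtain ⟨m, hm⟩ := hdvd
    have hpos : 0 < Fintype.card (K ≃ₐ[ℚ] K) := Fintype.card_pos
    omega
  have htop : Subgroup.zpowers (conjGal : K ≃ₐ[ℚ] K) = ⊤ := by
    apply Subgroup.eq_top_of_card_eq
    rw [Nat.card_zpowers, orderOf_conjGal, Nat.card_eq_fintype_card, hcard]
  have hg : g ∈ Subgroup.zpowers (conjGal : K ≃ₐ[ℚ] K) := htop ▸ Subgroup.mem_top g
  obtain ⟨k, rfl⟩ := Subgroup.mem_zpowers_iff.1 hg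
  have h2 : (conjGal : K ≃ₐ[ℚ] K) ^ (2 : ℤ) = 1 := by
    rw [show (2 : ℤ) = ((2 : ℕ) : ℤ) from rfl, zpow_natCast, pow_two, conjGal_mul_conjGal]
  rcases Int.even_or_odd k with ⟨m, rfl⟩ | ⟨m, rfl⟩
  · left
    rw [← two_mul, zpow_mul, h2, one_zpow]
  · right
    rw [zpow_add, zpow_one, zpow_mul, h2, one_zpow, one_mul]

/-! ## §3 The reflection `τ`: fixes `a`, sends `b` to `b̄` -/

omit [IsCMField K] in
/-- If `b(K) ⊆ a(K)` then `b = a ∘ g` for an automorphism `g` of `K` (`a⁻¹ ∘ b` is an injective endomorphism of the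
number field `K`, hence bijective). [folklore] -/
theorem exists_algEquiv_comp_eq_of_forall_mem_range {a b : K →+* ℂ} (h : ∀ x, b x ∈ Set.range a) :
    ∃ g : K ≃ₐ[ℚ] K, b = a.comp g.toRingEquiv.toRingHom := by
  let aQ : K →ₐ[ℚ] ℂ := a.toRatAlgHom
  let bQ : K →ₐ[ℚ] ℂ := b.toRatAlgHom
  have hle : bQ.range ≤ aQ.range := by
    rintro _ ⟨y, rfl⟩
    obtain ⟨z, hz⟩ := h y
    exact ⟨z, hz⟩
  let ea : K ≃ₐ[ℚ] aQ.range := AlgEquiv.ofInjectiveField aQ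
  let eb : K ≃ₐ[ℚ] bQ.range := AlgEquiv.ofInjectiveField bQ
  let g₀ : K →ₐ[ℚ] K :=
    (ea.symm : aQ.range →ₐ[ℚ] K).comp ((Subalgebra.inclusion hle).comp (eb : K →ₐ[ℚ] bQ.range))
  have hea : ∀ w : aQ.range, a (ea.symm w) = w := fun w => by
    have h1 : ((ea (ea.symm w) : aQ.range) : ℂ) = a (ea.symm w) := rfl
    rw [← h1, AlgEquiv.apply_symm_apply]
  have hg₀ : ∀ x, a (g₀ x) = b x := fun x => by
    change a (ea.symm (Subalgebra.inclusion hle (eb x))) = b x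
    rw [hea, Subalgebra.coe_inclusion]
    rfl
  refine ⟨AlgEquiv.ofBijective g₀ (Algebra.IsAlgebraic.algHom_bijective g₀), RingHom.ext fun x => ?_⟩
  exact (hg₀ x).symm

/-- **The dihedral reflection.**  For a quartic CM field `K` and embeddings `a, b : K → ℂ` such that `b` is NOT a
twist `a ∘ g` (`g ∈ Aut(K)`), there is an automorphism `τ` of `ℂ` with `τ ∘ a = a` and `τ ∘ b = b̄`: some `b(x)`
lies outside the countable subfield `a(K)` and is moved by an automorphism fixing `a(K)` pointwise
(`Literature.FieldTheory.AlgClosed.Complex.exists_ringEquiv_fix_apply_ne`); that automorphism fixes `a` and `ā` and moves `b` inside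
`{a, ā, b, b̄}`, i.e. to `b̄`. [folklore] -/
theorem exists_ringAut_smul_eq_self_smul_eq_conjugate (h4 : Module.finrank ℚ K = 4) {a b : K →+* ℂ}
    (hb : ∀ g : K ≃ₐ[ℚ] K, b ≠ a.comp g.toRingEquiv.toRingHom) :
    ∃ τ : ℂ ≃+* ℂ, τ • a = a ∧ τ • b = conjugate b := by
  classical
  have hba : b ≠ a := fun h => hb 1 (by rw [h]; rfl)
  have hba' : b ≠ conjugate a := fun h => hb conjGal (by rw [h, conjugate_eq_comp_conjGal])
  -- some value of `b` lies outside `a(K)`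
  obtain ⟨x, hx⟩ : ∃ x : K, b x ∉ Set.range a := by
    by_contra h
    simp only [not_exists, not_not] at h
    obtain ⟨g, hg⟩ := exists_algEquiv_comp_eq_of_forall_mem_range h
    exact hb g hg
  -- an automorphism of `ℂ` fixing `a(K)` pointwise and moving `b x`
  haveI : Countable K := Literature.NumberTheory.Automorphic.NumberField.countable' K
  have hF : #(a.fieldRange) ≤ ℵ₀ := by
    rw [Cardinal.mk_le_aleph0_iff]
    exact (Set.countable_range (a : K → ℂ)).to_subtype
  obtain ⟨τ, hfix, hmove⟩ := Literature.FieldTheory.AlgClosed.Complex.exists_ringEquiv_fix_apply_ne a.fieldRange hF (z := b x)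
    (fun hmem => hx (RingHom.mem_fieldRange.1 hmem))
  have hτa : τ • a = a := RingHom.ext fun y => hfix (a y) (RingHom.mem_fieldRange.2 ⟨y, rfl⟩)
  refine ⟨τ, hτa, ?_⟩
  rcases eq_or_eq_or_eq_or_eq h4 hba hba' (τ • b) with h | h | h | h
  · exact absurd (smul_left_cancel τ (h.trans hτa.symm)) hba
  · refine absurd (smul_left_cancel τ (h.trans ?_)) hba'
    rw [smul_conjugate, hτa]
  · exact absurd (RingHom.congr_fun h x) hmove
  · exact h

/-- For `K/ℚ` NOT Galois the reflection exists for every pair `b ∉ {a, ā}` (`Aut(K) = {1, c}`). [folklore] -/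
theorem exists_ringAut_smul_eq_self_smul_eq_conjugate_of_not_isGalois (h4 : Module.finrank ℚ K = 4)
    (hK : ¬IsGalois ℚ K) {a b : K →+* ℂ} (hba : b ≠ a) (hba' : b ≠ conjugate a) :
    ∃ τ : ℂ ≃+* ℂ, τ • a = a ∧ τ • b = conjugate b := by
  refine exists_ringAut_smul_eq_self_smul_eq_conjugate h4 fun g hg => ?_
  rcases algEquiv_eq_one_or_eq_conjGal_of_not_isGalois h4 hK g with rfl | rfl
  · exact hba (by rw [hg]; rfl)
  · exact hba' (by rw [hg, conjugate_eq_comp_conjGal])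

/-! ## §4 Primitivity and nondegeneracy of the CM types of a non-Galois quartic CM field -/

/-- **With the reflection at hand, `Φ = {a, b}` is primitive**: `1` and `τ` separate the four embeddings by their
membership in `Φ` (Kubota's criterion `isPrimitive_iff_forall_eq`). [cite: Shimura1998, §8.2 Prop. 26] -/
theorem isPrimitive_of_reflection (h4 : Module.finrank ℚ K = 4) {a b : K →+* ℂ} (hba : b ≠ a)
    (hba' : b ≠ conjugate a) {τ : ℂ ≃+* ℂ} (hτa : τ • a = a) (hτb : τ • b = conjugate b)
    (Φ : CMType K) (hΦ : ∀ s, s ∈ Φ.1 ↔ s = a ∨ s = b) (φ₀ : K →+* ℂ) :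
    IsPrimitive (ℂ ≃+* ℂ) Φ.1 φ₀ := by
  haveI := isPretransitive_ringEquiv_complex (K := K)
  rw [isPrimitive_iff_forall_eq]
  intro x y hxy
  have ha : a ∈ Φ.1 := (hΦ a).2 (Or.inl rfl)
  have hb : b ∈ Φ.1 := (hΦ b).2 (Or.inr rfl)
  have hna : conjugate a ∉ Φ.1 := (mem_iff_conjugate_notMem Φ a).1 ha
  have hnb : conjugate b ∉ Φ.1 := (mem_iff_conjugate_notMem Φ b).1 hb
  have hτa' : τ • conjugate a = conjugate a := by rw [smul_conjugate, hτa]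
  have hτb' : τ • conjugate b = b := by rw [smul_conjugate, hτb, involutive_conjugate]
  have h1 := hxy 1
  have h2 := hxy τ
  simp only [one_smul] at h1
  rcases eq_or_eq_or_eq_or_eq h4 hba hba' x with hx | hx | hx | hx <;>
    rcases eq_or_eq_or_eq_or_eq h4 hba hba' y with hy | hy | hy | hy <;>
    rw [hx, hy] at h1 h2 ⊢ <;>
    first
    | rfl
    | (exfalso; simp only [hτa, hτa', hτb, hτb'] at h2; tauto)

/-- **Every CM type of a non-Galois quartic CM field is primitive** (its abelian surfaces are simple; equivalently
the field has no imaginary quadratic subfield). [cite: Shimura1998, §8.2 Prop. 26] -/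
theorem isPrimitive_of_not_isGalois (h4 : Module.finrank ℚ K = 4) (hK : ¬IsGalois ℚ K) (Φ : CMType K)
    (φ₀ : K →+* ℂ) : IsPrimitive (ℂ ≃+* ℂ) Φ.1 φ₀ := by
  obtain ⟨a, b, hba, hba', hΦ⟩ := exists_mem_mem_ne h4 Φ
  obtain ⟨τ, hτa, hτb⟩ := exists_ringAut_smul_eq_self_smul_eq_conjugate_of_not_isGalois h4 hK hba hba'
  exact isPrimitive_of_reflection h4 hba hba' hτa hτb Φ hΦ φ₀

/-- **Every CM type of a non-Galois quartic CM field is NONDEGENERATE** (primitive, and Ribet's bound in degree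
`≤ 6`: `Pohlmann1968.isNondegenerate_of_isPrimitive_of_finrank_le_six`); so all powers of its abelian surfaces have
`B• = D•` (`Pohlmann1968.IsNondegenerate.hodgeClassSpan_pow_eq_divisorClassesSpan`). [cite: Ribet1980, (3.7)] -/
theorem isNondegenerate_of_not_isGalois (h4 : Module.finrank ℚ K = 4) (hK : ¬IsGalois ℚ K) (Φ : CMType K) :
    IsNondegenerate Φ := by
  obtain ⟨φ₀⟩ : Nonempty (K →+* ℂ) := inferInstance
  exact isNondegenerate_of_isPrimitive_of_finrank_le_six Φ (by rw [h4]; norm_num) φ₀ (isPrimitive_of_not_isGalois h4 hK Φ φ₀)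

end Summit.HodgeConjecture.CorCM.QuarticCM

end
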